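import Literature.NumberTheory.Sieve.FGKMT2018LocalPairSumVanishing
import HarnessLib

/-!
# FGKMT 2018 Theorem 6 / Maynard 2016 Prop. 9.1: the local factor `S_p` of `T(r,s)` — (9.5)

Sources: J. Maynard, *Dense clusters of primes in subsets*, Compositio Math. 152 (2016) =
arXiv:1405.2593 [Maynard2016DenseClusters], proof of Proposition 9.1 p. 19, display (9.5):
«the `d, e` sum is then a multiplicative function, so `T(r,s) = ∏_{p ∣ rs} S_p(r,s)` with
`S_p = p − 1` if `p ∣ (rⱼ, sⱼ)` for some `j`, `S_p = −1` if `p ∣ rᵢ`, `p ∣ sⱼ` with `i ≠ j`,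
`S_p = 0` if `p` divides one of `r, s` but not the other»; K. Ford, B. Green, S. Konyagin,
J. Maynard, T. Tao, *Long gaps between primes*, JAMS 31 (2018) = arXiv:1412.5029v4
[FordGreenKonyaginMaynardTao2018], (7.7) p. 21.

PROVED here (no named facts), continuing `FGKMT2018LocalPairSumVanishing` (the case
`S_p = 0`): the ONE-PRIME PEELING STEP of the multiplicative evaluation,

* `pairTerm d e` — the summand `μ(d)μ(e)de/∏[dᵢ,eᵢ]` of `T(r,s)` on cross-coprime pairs
  (`0` otherwise), `localPairSum_eq_sum_pairTerm`, `pairTerm_comm`;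
* scaling of the summand under `dⱼ ↦ p dⱼ` (`pairTerm_update_mul_left/right = −pairTerm`),
  under `(dⱼ, eⱼ) ↦ (p dⱼ, p eⱼ)` (`pairTerm_update_mul_both = p · pairTerm`) and vanishing under
  `(dⱼ, e_{j'}) ↦ (p dⱼ, p e_{j'})`, `j ≠ j'` (`pairTerm_update_mul_update_mul_of_ne`);
* the divisor-sum splitting `sum_filter_dvd_eq_sum_add` (`∑_{d ∣ r} G(d) = ∑_{d ∣ r'} (G(d) +
  G(d p@j))`, `r' = r` with `p` removed from `rⱼ`);
* **`localPairSum_peel`**: for `r, s ∈ 𝒟_k(𝓛)` and a prime `p ∣ rⱼ`, `p ∣ s_{j'}`,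
  `T(r,s) = S_p · T(r', s')` with `S_p = p − 1` if `j = j'` and `S_p = −1` if `j ≠ j'`
  (`r' = r/p@j`, `s' = s/p@j'`, both again in `𝒟_k(𝓛)`: `update_div_mem_dkBox`).

* **`localPairSum_eq_prod_localFactor`** — iterating over the primes of `∏rᵢ = ∏sᵢ` (base
  `localPairSum_one_one`): `T(r,s) = ∏_{p ∣ r} S_p(r,s)` with `localFactor r s p = S_p ∈
  {p − 1, −1}` — display (9.5) (`= μ(A)φ(r)/φ(A)`, `A = r/∏(rᵢ,sᵢ)`). With
  `localPairSum_eq_zero_of_prod_ne` this evaluates `T(r,s)` completely; what remains of the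
  main term of Prop. 9.1 is (9.3)–(9.4) (Lemma 8.2(ii) + Lemma 8.4).

## References
* J. Maynard, *Dense clusters of primes in subsets*, Compositio Math. 152 (2016), (9.5)
  [Maynard2016DenseClusters].
* K. Ford, B. Green, S. Konyagin, J. Maynard, T. Tao, *Long gaps between primes*, JAMS 31 (2018),
  (7.7) [FordGreenKonyaginMaynardTao2018].
-/

noncomputable section

open Finset
open scoped ArithmeticFunction.Moebius

namespace Literature.NumberTheory.Sieve.FGKMT2018

variable {k : ℕ}

/-! ### The summand `pairTerm` -/

/-- The summand of `T(r,s)` (Maynard (9.2)/(9.5)): `μ(d)μ(e)·de/∏ᵢ[dᵢ,eᵢ]` if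
`(dᵢeᵢ, d_le_l) = 1` for all `i ≠ l`, and `0` otherwise (`d = ∏dᵢ`, `e = ∏eᵢ`).
[cite: Maynard2016DenseClusters, (9.2) p. 19] -/
def pairTerm (d e : Fin k → ℕ) : ℝ :=
  if ∀ i l, i ≠ l → (d i * e i).Coprime (d l * e l) then
    ((μ (∏ i, d i) : ℤ) : ℝ) * ((μ (∏ i, e i) : ℤ) : ℝ) * ((∏ i, (d i : ℝ)) * ∏ i, (e i : ℝ)) /
      ∏ i, ((Nat.lcm (d i) (e i) : ℕ) : ℝ)
  else 0

/-- `T(r,s) = ∑_{d ∣ r} ∑_{e ∣ s} pairTerm d e`. [cite: Maynard2016DenseClusters, (9.2) p. 19] -/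
theorem localPairSum_eq_sum_pairTerm (L : Fin k → ℤ × ℤ) (B : ℕ) (R : ℝ) (r s : Fin k → ℕ) :
    localPairSum L B R r s = ∑ d ∈ (dkBox L B R).filter (fun d => ∀ i, d i ∣ r i),
      ∑ e ∈ (dkBox L B R).filter (fun e => ∀ i, e i ∣ s i), pairTerm d e := rfl

/-- The cross-coprimality condition is symmetric in `d, e`. [cite: Maynard2016DenseClusters, (9.2) p. 19] -/
theorem cross_comm (d e : Fin k → ℕ) :
    (∀ i l, i ≠ l → (d i * e i).Coprime (d l * e l)) ↔
      ∀ i l, i ≠ l → (e i * d i).Coprime (e l * d l) := by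
  simp only [mul_comm]

/-- `pairTerm d e = pairTerm e d`. [cite: Maynard2016DenseClusters, (9.2) p. 19] -/
theorem pairTerm_comm (d e : Fin k → ℕ) : pairTerm d e = pairTerm e d := by
  unfold pairTerm
  by_cases h : ∀ i l, i ≠ l → (d i * e i).Coprime (d l * e l)
  · rw [if_pos h, if_pos ((cross_comm d e).1 h)]
    simp only [Nat.lcm_comm (d _) (e _)]
    ring
  · rw [if_neg h, if_neg (fun h' => h ((cross_comm d e).2 h'))]

/-- `T(1,1) = 1` (for `R > 1`, so that `1 ∈ 𝒟_k`). [cite: Maynard2016DenseClusters, proof of Prop. 9.1 p. 19] -/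
theorem pairTerm_one_one : pairTerm (fun _ : Fin k => 1) (fun _ => 1) = 1 := by
  unfold pairTerm
  rw [if_pos (fun i l _ => by simp)]
  simp

/-! ### Scaling of the summand at one prime -/

/-- `∏ᵢ (d with dⱼ ↦ dⱼ p)ᵢ = p ∏ᵢ dᵢ`. [cite: Maynard2016DenseClusters, proof of Prop. 9.1 p. 19, (9.5)] -/
theorem prod_update_mul (d : Fin k → ℕ) (j : Fin k) (p : ℕ) :
    ∏ i, Function.update d j (d j * p) i = p * ∏ i, d i := by
  have hP0 : ∏ i, d i = d j * ∏ i ∈ Finset.univ \ {j}, d i := by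
    conv_lhs => rw [← Function.update_eq_self j d]
    exact Finset.prod_update_of_mem (Finset.mem_univ j) d (d j)
  rw [Finset.prod_update_of_mem (Finset.mem_univ j) d _, hP0]
  ring

/-- `μ(p d) = −μ(d)` for the updated vector, `p ∤ dᵢ` for all `i`.
[cite: Maynard2016DenseClusters, proof of Prop. 9.1 p. 19, (9.5)] -/
theorem moebius_prod_update_mul (d : Fin k → ℕ) (j : Fin k) {p : ℕ} (hp : p.Prime)
    (hd : ∀ i, ¬ p ∣ d i) :
    μ (∏ i, Function.update d j (d j * p) i) = -μ (∏ i, d i) := by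
  have hnd : ¬ p ∣ ∏ i, d i := by
    rw [(Nat.prime_iff.1 hp).dvd_finsetProd_iff]
    rintro ⟨i, -, hi⟩
    exact hd i hi
  rw [prod_update_mul, ArithmeticFunction.isMultiplicative_moebius.map_mul_of_coprime
      ((Nat.Prime.coprime_iff_not_dvd hp).2 hnd), ArithmeticFunction.moebius_apply_prime hp]
  ring

/-- `∏ᵢ [(d p@j)ᵢ, eᵢ] = p ∏ᵢ [dᵢ, eᵢ]` when `p ∤ eⱼ`. [cite: Maynard2016DenseClusters, proof of Prop. 9.1 p. 19, (9.5)] -/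
theorem prod_lcm_update_mul (d e : Fin k → ℕ) (j : Fin k) {p : ℕ} (hp : p.Prime) (hej : ¬ p ∣ e j) :
    ∏ i, Nat.lcm (Function.update d j (d j * p) i) (e i) = p * ∏ i, Nat.lcm (d i) (e i) := by
  have hfun : (fun i => Nat.lcm (Function.update d j (d j * p) i) (e i)) =
      Function.update (fun i => Nat.lcm (d i) (e i)) j (Nat.lcm (d j * p) (e j)) := by
    funext i
    by_cases hi : i = j
    · subst hi; simp only [Function.update_self]
    · simp only [Function.update_of_ne hi]
  have hQ0 : ∏ i, Nat.lcm (d i) (e i) = Nat.lcm (d j) (e j) * ∏ i ∈ Finset.univ \ {j}, Nat.lcm (d i) (e i) := by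
    conv_lhs => rw [← Function.update_eq_self j (fun i => Nat.lcm (d i) (e i))]
    exact Finset.prod_update_of_mem (Finset.mem_univ j) (fun i => Nat.lcm (d i) (e i)) _
  have hlcm : Nat.lcm (d j * p) (e j) = p * Nat.lcm (d j) (e j) := by
    have hpb : p.Coprime (e j) := (Nat.Prime.coprime_iff_not_dvd hp).2 hej
    rw [mul_comm (d j) p, Nat.lcm, Nat.lcm, Nat.Coprime.gcd_mul_left_cancel (d j) hpb, mul_assoc,
      Nat.mul_div_assoc p ((Nat.gcd_dvd_left (d j) (e j)).mul_right (e j))]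
  rw [hfun, Finset.prod_update_of_mem (Finset.mem_univ j) _ _, hQ0, hlcm]
  ring

/-- `∏ᵢ [(d p@j)ᵢ, (e p@j)ᵢ] = p ∏ᵢ [dᵢ, eᵢ]`. [cite: Maynard2016DenseClusters, proof of Prop. 9.1 p. 19, (9.5)] -/
theorem prod_lcm_update_mul_update_mul (d e : Fin k → ℕ) (j : Fin k) (p : ℕ) :
    ∏ i, Nat.lcm (Function.update d j (d j * p) i) (Function.update e j (e j * p) i) =
      p * ∏ i, Nat.lcm (d i) (e i) := by
  have hfun : (fun i => Nat.lcm (Function.update d j (d j * p) i) (Function.update e j (e j * p) i)) =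
      Function.update (fun i => Nat.lcm (d i) (e i)) j (Nat.lcm (d j * p) (e j * p)) := by
    funext i
    by_cases hi : i = j
    · subst hi; simp only [Function.update_self]
    · simp only [Function.update_of_ne hi]
  have hQ0 : ∏ i, Nat.lcm (d i) (e i) = Nat.lcm (d j) (e j) * ∏ i ∈ Finset.univ \ {j}, Nat.lcm (d i) (e i) := by
    conv_lhs => rw [← Function.update_eq_self j (fun i => Nat.lcm (d i) (e i))]
    exact Finset.prod_update_of_mem (Finset.mem_univ j) (fun i => Nat.lcm (d i) (e i)) _
  rw [hfun, Finset.prod_update_of_mem (Finset.mem_univ j) _ _, hQ0, Nat.lcm_mul_right]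
  ring

/-- Cross-coprimality is invariant under `dⱼ ↦ dⱼ p` when `p ∤ d_l e_l` for `l ≠ j`.
[cite: Maynard2016DenseClusters, proof of Prop. 9.1 p. 19 (∑' restriction)] -/
theorem cross_update_mul_iff (d e : Fin k → ℕ) (j : Fin k) {p : ℕ} (hp : p.Prime)
    (hd : ∀ l, l ≠ j → ¬ p ∣ d l) (he : ∀ l, l ≠ j → ¬ p ∣ e l) :
    (∀ i l, i ≠ l → (Function.update d j (d j * p) i * e i).Coprime
        (Function.update d j (d j * p) l * e l)) ↔
      ∀ i l, i ≠ l → (d i * e i).Coprime (d l * e l) := by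
  refine cross_update_iff d e j _ fun n hn => ?_
  obtain ⟨l, hl, rfl⟩ := hn
  have hpn : ¬ p ∣ d l * e l := by
    rw [hp.dvd_mul, not_or]; exact ⟨hd l hl, he l hl⟩
  rw [show d j * p * e j = p * (d j * e j) by ring, coprime_prime_mul_iff hp hpn]

/-- `∏ᵢ [dᵢ, eᵢ] ≠ 0` when no `dᵢ, eᵢ` is divisible by `p` (so none is `0`). [cite: Maynard2016DenseClusters, proof of Prop. 9.1 p. 19] -/
theorem prod_lcm_ne_zero {d e : Fin k → ℕ} {p : ℕ} (hd : ∀ i, ¬ p ∣ d i) (he : ∀ i, ¬ p ∣ e i) :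
    (∏ i, ((Nat.lcm (d i) (e i) : ℕ) : ℝ)) ≠ 0 := by
  refine Finset.prod_ne_zero_iff.2 fun i _ => ?_
  have h1 : d i ≠ 0 := fun h0 => hd i (by rw [h0]; exact dvd_zero p)
  have h2 : e i ≠ 0 := fun h0 => he i (by rw [h0]; exact dvd_zero p)
  exact_mod_cast (Nat.lcm_pos (Nat.pos_of_ne_zero h1) (Nat.pos_of_ne_zero h2)).ne'

/-- **Scaling `dⱼ ↦ p dⱼ`**: the summand changes sign (`μ` flips, `d` and `∏[dᵢ,eᵢ]` both gain
the factor `p`), for `p ∤ d, e`. [cite: Maynard2016DenseClusters, proof of Prop. 9.1 p. 19, (9.5)] -/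
theorem pairTerm_update_mul_left (d e : Fin k → ℕ) (j : Fin k) {p : ℕ} (hp : p.Prime)
    (hd : ∀ i, ¬ p ∣ d i) (he : ∀ i, ¬ p ∣ e i) :
    pairTerm (Function.update d j (d j * p)) e = -pairTerm d e := by
  have hp0 : (p : ℝ) ≠ 0 := by exact_mod_cast hp.ne_zero
  have hΛ := prod_lcm_ne_zero hd he
  have hc := cross_update_mul_iff d e j hp (fun l _ => hd l) (fun l _ => he l)
  have hD : (∏ i, ((Function.update d j (d j * p) i : ℕ) : ℝ)) = p * ∏ i, (d i : ℝ) := by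
    have := congrArg (fun n : ℕ => (n : ℝ)) (prod_update_mul d j p)
    push_cast at this
    exact this
  have hL : (∏ i, ((Nat.lcm (Function.update d j (d j * p) i) (e i) : ℕ) : ℝ)) =
      p * ∏ i, ((Nat.lcm (d i) (e i) : ℕ) : ℝ) := by
    have := congrArg (fun n : ℕ => (n : ℝ)) (prod_lcm_update_mul d e j hp (he j))
    push_cast at this
    exact this
  unfold pairTerm
  by_cases hcr : ∀ i l, i ≠ l → (d i * e i).Coprime (d l * e l)
  · rw [if_pos hcr, if_pos (hc.2 hcr), moebius_prod_update_mul d j hp hd, hD, hL]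
    push_cast
    field_simp
  · rw [if_neg hcr, if_neg (fun h => hcr (hc.1 h)), neg_zero]

/-- Scaling `eⱼ ↦ p eⱼ`: the summand changes sign. [cite: Maynard2016DenseClusters, proof of Prop. 9.1 p. 19, (9.5)] -/
theorem pairTerm_update_mul_right (d e : Fin k → ℕ) (j : Fin k) {p : ℕ} (hp : p.Prime)
    (hd : ∀ i, ¬ p ∣ d i) (he : ∀ i, ¬ p ∣ e i) :
    pairTerm d (Function.update e j (e j * p)) = -pairTerm d e := by
  rw [pairTerm_comm, pairTerm_update_mul_left e d j hp he hd, pairTerm_comm]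

/-- **Scaling `(dⱼ, eⱼ) ↦ (p dⱼ, p eⱼ)`** (same coordinate): the summand gains the factor
`p² / p = p` (`S_p = p − 1` case). [cite: Maynard2016DenseClusters, proof of Prop. 9.1 p. 19, (9.5)] -/
theorem pairTerm_update_mul_both (d e : Fin k → ℕ) (j : Fin k) {p : ℕ} (hp : p.Prime)
    (hd : ∀ i, ¬ p ∣ d i) (he : ∀ i, ¬ p ∣ e i) :
    pairTerm (Function.update d j (d j * p)) (Function.update e j (e j * p)) = (p : ℝ) * pairTerm d e := by
  have hp0 : (p : ℝ) ≠ 0 := by exact_mod_cast hp.ne_zero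
  have hΛ := prod_lcm_ne_zero hd he
  -- cross invariance in two steps
  have hc1 := cross_update_mul_iff d (Function.update e j (e j * p)) j hp (fun l _ => hd l)
    (fun l hl => by rw [Function.update_of_ne hl]; exact he l)
  have hc2 := cross_update_mul_iff e d j hp (fun l _ => he l) (fun l _ => hd l)
  have hc : (∀ i l, i ≠ l → (Function.update d j (d j * p) i * Function.update e j (e j * p) i).Coprime
      (Function.update d j (d j * p) l * Function.update e j (e j * p) l)) ↔
      ∀ i l, i ≠ l → (d i * e i).Coprime (d l * e l) := by
    rw [hc1, cross_comm, hc2, cross_comm]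
  have hD : (∏ i, ((Function.update d j (d j * p) i : ℕ) : ℝ)) = p * ∏ i, (d i : ℝ) := by
    have := congrArg (fun n : ℕ => (n : ℝ)) (prod_update_mul d j p)
    push_cast at this
    exact this
  have hE : (∏ i, ((Function.update e j (e j * p) i : ℕ) : ℝ)) = p * ∏ i, (e i : ℝ) := by
    have := congrArg (fun n : ℕ => (n : ℝ)) (prod_update_mul e j p)
    push_cast at this
    exact this
  have hL : (∏ i, ((Nat.lcm (Function.update d j (d j * p) i) (Function.update e j (e j * p) i) : ℕ) : ℝ)) =
      p * ∏ i, ((Nat.lcm (d i) (e i) : ℕ) : ℝ) := by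
    have := congrArg (fun n : ℕ => (n : ℝ)) (prod_lcm_update_mul_update_mul d e j p)
    push_cast at this
    exact this
  unfold pairTerm
  by_cases hcr : ∀ i l, i ≠ l → (d i * e i).Coprime (d l * e l)
  · rw [if_pos hcr, if_pos (hc.2 hcr), moebius_prod_update_mul d j hp hd,
      moebius_prod_update_mul e j hp he, hD, hE, hL]
    push_cast
    field_simp
  · rw [if_neg hcr, if_neg (fun h => hcr (hc.1 h)), mul_zero]

/-- Scaling `(dⱼ, e_{j'}) ↦ (p dⱼ, p e_{j'})` with `j ≠ j'` kills the summand: the pair is no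
longer cross-coprime (`S_p = −1` case: the `(1,1)` term is absent). [cite: Maynard2016DenseClusters, proof of Prop. 9.1 p. 19, (9.5)] -/
theorem pairTerm_update_mul_update_mul_of_ne (d e : Fin k → ℕ) {j j' : Fin k} (hjj' : j ≠ j')
    {p : ℕ} (hp : p.Prime) :
    pairTerm (Function.update d j (d j * p)) (Function.update e j' (e j' * p)) = 0 := by
  unfold pairTerm
  rw [if_neg]
  intro h
  have h1 := h j j' hjj'
  rw [Function.update_self, Function.update_self, Function.update_of_ne hjj',
    Function.update_of_ne (Ne.symm hjj')] at h1
  exact Nat.not_coprime_of_dvd_of_dvd hp.one_lt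
    ((dvd_mul_left p (d j)).mul_right _) ((dvd_mul_left p (e j')).mul_left _) h1

/-! ### Splitting the divisor sum at one prime -/

/-- For `r ∈ 𝒟_k(𝓛)` and a prime `p ∣ rⱼ`: `d ∣ r/p@j` iff `d ∣ r` and `p ∤ dⱼ`.
[cite: Maynard2016DenseClusters, proof of Prop. 9.1 p. 19 (multiplicativity in (9.5))] -/
theorem dvd_update_div_iff {L : Fin k → ℤ × ℤ} {B : ℕ} {R : ℝ} {r : Fin k → ℕ}
    (hr : r ∈ dkBox L B R) {p : ℕ} (hp : p.Prime) {j : Fin k} (hpj : p ∣ r j) (d : Fin k → ℕ) :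
    (∀ i, d i ∣ Function.update r j (r j / p) i) ↔ (∀ i, d i ∣ r i) ∧ ¬ p ∣ d j := by
  have hrsq : Squarefree (r j) := squarefree_apply_of_mem_dkBox hr j
  have hndiv : ¬ p ∣ r j / p := by
    rw [Nat.dvd_div_iff_mul_dvd hpj]
    exact fun h => hp.not_isUnit (hrsq p h)
  constructor
  · intro h
    refine ⟨fun i => ?_, fun hpd => hndiv (hpd.trans (by simpa using h j))⟩
    by_cases hi : i = j
    · subst hi
      exact (by simpa using h i : d i ∣ r i / p).trans (Nat.div_dvd_of_dvd hpj)
    · simpa [Function.update_of_ne hi] using h i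
  · rintro ⟨h, hpd⟩ i
    by_cases hi : i = j
    · subst hi
      rw [Function.update_self]
      have hcop : (d i).Coprime p := Nat.coprime_comm.1 ((Nat.Prime.coprime_iff_not_dvd hp).2 hpd)
      exact hcop.dvd_of_dvd_mul_right (by rw [Nat.div_mul_cancel hpj]; exact h i)
    · rw [Function.update_of_ne hi]; exact h i

/-- `r/p@j ∈ 𝒟_k(𝓛)` for `r ∈ 𝒟_k(𝓛)`, `p ∣ rⱼ`. [cite: Maynard2016DenseClusters, §7 p. 13 (𝒟_k)] -/
theorem update_div_mem_dkBox {L : Fin k → ℤ × ℤ} {B : ℕ} {R : ℝ} {r : Fin k → ℕ}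
    (hr : r ∈ dkBox L B R) (j : Fin k) {p : ℕ} (hpj : p ∣ r j) :
    Function.update r j (r j / p) ∈ dkBox L B R := by
  refine mem_dkBox_of_dvd hr fun i => ?_
  by_cases hi : i = j
  · subst hi; rw [Function.update_self]; exact Nat.div_dvd_of_dvd hpj
  · rw [Function.update_of_ne hi]

/-- **Splitting the divisor sum at `p`**: for `r ∈ 𝒟_k(𝓛)`, a prime `p ∣ rⱼ` and any `G`,
`∑_{d ∣ r} G(d) = ∑_{d ∣ r/p@j} (G(d) + G(d·p@j))`.
[cite: Maynard2016DenseClusters, proof of Prop. 9.1 p. 19 (multiplicativity in (9.5))] -/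
theorem sum_filter_dvd_eq_sum_add {L : Fin k → ℤ × ℤ} {B : ℕ} {R : ℝ} {r : Fin k → ℕ}
    (hr : r ∈ dkBox L B R) {p : ℕ} (hp : p.Prime) {j : Fin k} (hpj : p ∣ r j)
    (G : (Fin k → ℕ) → ℝ) :
    ∑ d ∈ (dkBox L B R).filter (fun d => ∀ i, d i ∣ r i), G d =
      ∑ d ∈ (dkBox L B R).filter (fun d => ∀ i, d i ∣ Function.update r j (r j / p) i),
        (G d + G (Function.update d j (d j * p))) := by
  classical
  have hA : ∑ d ∈ (dkBox L B R).filter (fun d => ∀ i, d i ∣ Function.update r j (r j / p) i), G d =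
      ∑ d ∈ ((dkBox L B R).filter (fun d => ∀ i, d i ∣ r i)).filter (fun d => ¬ p ∣ d j), G d := by
    refine Finset.sum_congr (Finset.ext fun d => ?_) fun _ _ => rfl
    simp only [Finset.mem_filter, dvd_update_div_iff hr hp hpj, and_assoc]
  have hB : ∑ d ∈ (dkBox L B R).filter (fun d => ∀ i, d i ∣ Function.update r j (r j / p) i),
      G (Function.update d j (d j * p)) =
      ∑ d ∈ ((dkBox L B R).filter (fun d => ∀ i, d i ∣ r i)).filter (fun d => p ∣ d j), G d := by
    refine Finset.sum_bij' (fun d _ => Function.update d j (d j * p))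
      (fun d _ => Function.update d j (d j / p)) ?_ ?_ ?_ ?_ (fun _ _ => rfl)
    · intro d hd
      obtain ⟨-, hdr'⟩ := Finset.mem_filter.1 hd
      obtain ⟨hdr, -⟩ := (dvd_update_div_iff hr hp hpj d).1 hdr'
      have hdiv : ∀ i, Function.update d j (d j * p) i ∣ r i := by
        intro i
        by_cases hi : i = j
        · subst hi
          rw [Function.update_self]
          have h := hdr' i
          rw [Function.update_self] at h
          have := Nat.mul_dvd_mul_right h p
          rwa [Nat.div_mul_cancel hpj] at this
        · rw [Function.update_of_ne hi]; exact hdr i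
      refine Finset.mem_filter.2 ⟨Finset.mem_filter.2 ⟨mem_dkBox_of_dvd hr hdiv, hdiv⟩, ?_⟩
      rw [Function.update_self]; exact dvd_mul_left p (d j)
    · intro d hd
      obtain ⟨hd1, hpd⟩ := Finset.mem_filter.1 hd
      obtain ⟨-, hdr⟩ := Finset.mem_filter.1 hd1
      have hdiv : ∀ i, Function.update d j (d j / p) i ∣ Function.update r j (r j / p) i := by
        intro i
        by_cases hi : i = j
        · subst hi
          rw [Function.update_self, Function.update_self]
          exact Nat.dvd_div_of_mul_dvd (by rw [Nat.mul_div_cancel' hpd]; exact hdr i)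
        · rw [Function.update_of_ne hi, Function.update_of_ne hi]; exact hdr i
      exact Finset.mem_filter.2 ⟨mem_dkBox_of_dvd (update_div_mem_dkBox hr j hpj) hdiv, hdiv⟩
    · intro d hd
      rw [Function.update_idem, Function.update_self, Nat.mul_div_cancel _ hp.pos,
        Function.update_eq_self]
    · intro d hd
      obtain ⟨-, hpd⟩ := Finset.mem_filter.1 hd
      rw [Function.update_idem, Function.update_self, Nat.div_mul_cancel hpd, Function.update_eq_self]
  rw [Finset.sum_add_distrib, hA, hB, add_comm, Finset.sum_filter_add_sum_filter_not]

/-! ### The peeling step `T(r,s) = S_p · T(r/p, s/p)` -/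

/-- No coordinate of a divisor of `r/p@j` is divisible by `p` (`r ∈ 𝒟_k(𝓛)`, `p ∣ rⱼ`).
[cite: Maynard2016DenseClusters, §7 p. 13 (𝒟_k: `∏rᵢ` squarefree)] -/
theorem not_dvd_of_dvd_update_div {L : Fin k → ℤ × ℤ} {B : ℕ} {R : ℝ} {r : Fin k → ℕ}
    (hr : r ∈ dkBox L B R) {p : ℕ} (hp : p.Prime) {j : Fin k} (hpj : p ∣ r j) {d : Fin k → ℕ}
    (hd : ∀ i, d i ∣ Function.update r j (r j / p) i) (i : Fin k) : ¬ p ∣ d i := by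
  intro hpi
  obtain ⟨hdr, hpdj⟩ := (dvd_update_div_iff hr hp hpj d).1 hd
  by_cases hi : i = j
  · subst hi; exact hpdj hpi
  · have hg := Nat.dvd_gcd (hpi.trans (hdr i)) hpj
    rw [(coprime_apply_of_mem_dkBox hr hi).gcd_eq_one] at hg
    exact hp.one_lt.ne' (Nat.dvd_one.1 hg)

/-- **Maynard (9.5), one prime at a time.** For `r, s ∈ 𝒟_k(𝓛)` and a prime `p` with
`p ∣ rⱼ`, `p ∣ s_{j'}`: `T(r,s) = S_p · T(r/p@j, s/p@j')` where `S_p = p − 1` if `j = j'`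
(`p ∣ (rⱼ, sⱼ)`) and `S_p = −1` if `j ≠ j'`. [cite: Maynard2016DenseClusters, proof of Prop. 9.1 p. 19, (9.5)] -/
theorem localPairSum_peel {L : Fin k → ℤ × ℤ} {B : ℕ} {R : ℝ} {r s : Fin k → ℕ}
    (hr : r ∈ dkBox L B R) (hs : s ∈ dkBox L B R) {p : ℕ} (hp : p.Prime) {j j' : Fin k}
    (hpj : p ∣ r j) (hpj' : p ∣ s j') :
    localPairSum L B R r s = (if j = j' then (p : ℝ) - 1 else -1) *
      localPairSum L B R (Function.update r j (r j / p)) (Function.update s j' (s j' / p)) := by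
  classical
  rw [localPairSum_eq_sum_pairTerm, localPairSum_eq_sum_pairTerm,
    sum_filter_dvd_eq_sum_add hr hp hpj, Finset.mul_sum]
  refine Finset.sum_congr rfl fun d hd => ?_
  have hd' : ∀ i, ¬ p ∣ d i := not_dvd_of_dvd_update_div hr hp hpj (Finset.mem_filter.1 hd).2
  rw [sum_filter_dvd_eq_sum_add hs hp hpj', sum_filter_dvd_eq_sum_add hs hp hpj',
    ← Finset.sum_add_distrib, Finset.mul_sum]
  refine Finset.sum_congr rfl fun e he => ?_
  have he' : ∀ i, ¬ p ∣ e i := not_dvd_of_dvd_update_div hs hp hpj' (Finset.mem_filter.1 he).2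
  rw [pairTerm_update_mul_right d e j' hp hd' he', pairTerm_update_mul_left d e j hp hd' he']
  by_cases hjj : j = j'
  · subst hjj
    rw [if_pos rfl, pairTerm_update_mul_both d e j hp hd' he']
    ring
  · rw [if_neg hjj, pairTerm_update_mul_update_mul_of_ne d e hjj hp]
    ring

/-! ### Iterating: `T(r,s) = ∏_{p ∣ r} S_p(r,s)` — Maynard (9.5) -/

/-- The local factor `S_p(r,s)` of (9.5) for `∏rᵢ = ∏sᵢ`: `p − 1` if `p ∣ (rⱼ, sⱼ)` for some `j`,
else `−1`. [cite: Maynard2016DenseClusters, proof of Prop. 9.1 p. 19, (9.5)] -/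
def localFactor (r s : Fin k → ℕ) (p : ℕ) : ℝ :=
  if ∃ i, p ∣ r i ∧ p ∣ s i then (p : ℝ) - 1 else -1

/-- `(1,…,1) ∈ 𝒟_k(𝓛)` as soon as `𝒟_k(𝓛)` is non-empty. [cite: Maynard2016DenseClusters, §7 p. 13 (𝒟_k)] -/
theorem one_mem_dkBox_of_mem {L : Fin k → ℤ × ℤ} {B : ℕ} {R : ℝ} {r : Fin k → ℕ}
    (hr : r ∈ dkBox L B R) : (fun _ : Fin k => (1 : ℕ)) ∈ dkBox L B R :=
  mem_dkBox_of_dvd hr fun _ => one_dvd _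

/-- `T(1,1) = 1`. [cite: Maynard2016DenseClusters, proof of Prop. 9.1 p. 19] -/
theorem localPairSum_one_one {L : Fin k → ℤ × ℤ} {B : ℕ} {R : ℝ}
    (h1 : (fun _ : Fin k => (1 : ℕ)) ∈ dkBox L B R) :
    localPairSum L B R (fun _ => 1) (fun _ => 1) = 1 := by
  classical
  have hset : (dkBox L B R).filter (fun d => ∀ i, d i ∣ (fun _ : Fin k => (1 : ℕ)) i) =
      {fun _ => 1} := by
    ext d
    simp only [Finset.mem_filter, Finset.mem_singleton, Nat.dvd_one]
    constructor
    · rintro ⟨-, h⟩; exact funext h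
    · rintro rfl; exact ⟨h1, fun _ => rfl⟩
  rw [localPairSum_eq_sum_pairTerm, hset, Finset.sum_singleton, Finset.sum_singleton,
    pairTerm_one_one]

/-- `p ∏ᵢ (r/p@j)ᵢ = ∏ᵢ rᵢ` for `p ∣ rⱼ`. [cite: Maynard2016DenseClusters, proof of Prop. 9.1 p. 19, (9.5)] -/
theorem mul_prod_update_div (r : Fin k → ℕ) (j : Fin k) {p : ℕ} (hpj : p ∣ r j) :
    p * ∏ i, Function.update r j (r j / p) i = ∏ i, r i := by
  have h := prod_update_mul (Function.update r j (r j / p)) j p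
  rw [Function.update_idem, Function.update_self, Nat.div_mul_cancel hpj,
    Function.update_eq_self] at h
  exact h.symm

/-- For primes `q ≠ p` and `p ∣ rⱼ`: `q ∣ (r/p@j)ᵢ ↔ q ∣ rᵢ`. [cite: Maynard2016DenseClusters, proof of Prop. 9.1 p. 19, (9.5)] -/
theorem prime_dvd_update_div_iff (r : Fin k → ℕ) (j : Fin k) {p q : ℕ} (hp : p.Prime)
    (hq : q.Prime) (hqp : q ≠ p) (hpj : p ∣ r j) (i : Fin k) :
    q ∣ Function.update r j (r j / p) i ↔ q ∣ r i := by
  by_cases hi : i = j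
  · subst hi
    rw [Function.update_self]
    constructor
    · exact fun h => h.trans (Nat.div_dvd_of_dvd hpj)
    · intro h
      rw [← Nat.div_mul_cancel hpj, (Nat.prime_iff.1 hq).dvd_mul] at h
      rcases h with h | h
      · exact h
      · exact absurd ((Nat.prime_dvd_prime_iff_eq hq hp).1 h) hqp
  · rw [Function.update_of_ne hi]

/-- `(N/p).primeFactors = N.primeFactors \ {p}` for squarefree `N` and a prime `p ∣ N`.
[cite: Maynard2016DenseClusters, proof of Prop. 9.1 p. 19, (9.5)] -/
theorem primeFactors_div_of_squarefree {N p : ℕ} (hN : Squarefree N) (hp : p.Prime) (hpN : p ∣ N) :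
    (N / p).primeFactors = N.primeFactors.erase p := by
  have hN0 : N ≠ 0 := hN.ne_zero
  have hNp0 : N / p ≠ 0 := (Nat.div_pos (Nat.le_of_dvd (Nat.pos_of_ne_zero hN0) hpN) hp.pos).ne'
  have hndiv : ¬ p ∣ N / p := by
    rw [Nat.dvd_div_iff_mul_dvd hpN]
    exact fun h => hp.not_isUnit (hN p h)
  ext q
  rw [Finset.mem_erase, Nat.mem_primeFactors, Nat.mem_primeFactors]
  constructor
  · rintro ⟨hq, hqd, -⟩
    exact ⟨fun h => hndiv (h ▸ hqd), hq, hqd.trans (Nat.div_dvd_of_dvd hpN), hN0⟩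
  · rintro ⟨hqp, hq, hqN, -⟩
    refine ⟨hq, ?_, hNp0⟩
    rw [← Nat.div_mul_cancel hpN, (Nat.prime_iff.1 hq).dvd_mul] at hqN
    rcases hqN with h | h
    · exact h
    · exact absurd ((Nat.prime_dvd_prime_iff_eq hq hp).1 h) hqp

/-- **Maynard (9.5)**: for `r, s ∈ 𝒟_k(𝓛)` with `∏rᵢ = ∏sᵢ`,
`T(r,s) = ∏_{p ∣ r} S_p(r,s)` (`= μ(A)φ(r)/φ(A)` in Maynard's notation); together with
`localPairSum_eq_zero_of_prod_ne` this evaluates `T` completely.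
[cite: Maynard2016DenseClusters, proof of Prop. 9.1 p. 19, (9.5)] -/
theorem localPairSum_eq_prod_localFactor {L : Fin k → ℤ × ℤ} {B : ℕ} {R : ℝ} {r s : Fin k → ℕ}
    (hr : r ∈ dkBox L B R) (hs : s ∈ dkBox L B R) (heq : (∏ i, r i) = ∏ i, s i) :
    localPairSum L B R r s = ∏ p ∈ (∏ i, r i).primeFactors, localFactor r s p := by
  classical
  suffices h : ∀ N (r s : Fin k → ℕ), r ∈ dkBox L B R → s ∈ dkBox L B R →
      (∏ i, r i) = N → (∏ i, s i) = N →
      localPairSum L B R r s = ∏ p ∈ N.primeFactors, localFactor r s p from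
    h _ r s hr hs rfl heq.symm
  intro N
  induction N using Nat.strong_induction_on with
  | _ N ih =>
    intro r s hr hs hrN hsN
    by_cases hN1 : N = 1
    · subst hN1
      have hr1 : r = fun _ => 1 := funext fun i => Nat.dvd_one.1 (by
        rw [← hrN]; exact Finset.dvd_prod_of_mem r (Finset.mem_univ i))
      have hs1 : s = fun _ => 1 := funext fun i => Nat.dvd_one.1 (by
        rw [← hsN]; exact Finset.dvd_prod_of_mem s (Finset.mem_univ i))
      subst hr1 hs1
      rw [Nat.primeFactors_one, Finset.prod_empty, localPairSum_one_one hr]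
    · have hN0 : 0 < N := by
        rw [← hrN]; exact Finset.prod_pos fun i _ => one_le_of_mem_dkBox hr i
      have hp : N.minFac.Prime := Nat.minFac_prime hN1
      set p := N.minFac with hpdef
      have hpN : p ∣ N := Nat.minFac_dvd N
      have hpr : p ∣ ∏ i, r i := by rw [hrN]; exact hpN
      have hps : p ∣ ∏ i, s i := by rw [hsN]; exact hpN
      obtain ⟨j, -, hpj⟩ := ((Nat.prime_iff.1 hp).dvd_finsetProd_iff _).1 hpr
      obtain ⟨j', -, hpj'⟩ := ((Nat.prime_iff.1 hp).dvd_finsetProd_iff _).1 hps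
      rw [localPairSum_peel hr hs hp hpj hpj']
      have hr' := update_div_mem_dkBox hr j hpj
      have hs' := update_div_mem_dkBox hs j' hpj'
      have hr'N : (∏ i, Function.update r j (r j / p) i) = N / p :=
        (Nat.div_eq_of_eq_mul_right hp.pos (by rw [mul_prod_update_div r j hpj, hrN])).symm
      have hs'N : (∏ i, Function.update s j' (s j' / p) i) = N / p :=
        (Nat.div_eq_of_eq_mul_right hp.pos (by rw [mul_prod_update_div s j' hpj', hsN])).symm
      rw [ih (N / p) (Nat.div_lt_self hN0 hp.one_lt) _ _ hr' hs' hr'N hs'N,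
        primeFactors_div_of_squarefree (hrN ▸ squarefree_of_mem_dkBox hr) hp hpN,
        ← Finset.mul_prod_erase N.primeFactors (localFactor r s)
          (Nat.mem_primeFactors.2 ⟨hp, hpN, hN0.ne'⟩)]
      -- the local factor at `p`
      have hSp : localFactor r s p = if j = j' then (p : ℝ) - 1 else -1 := by
        unfold localFactor
        by_cases hjj : j = j'
        · subst hjj; rw [if_pos ⟨j, hpj, hpj'⟩, if_pos rfl]
        · rw [if_neg, if_neg hjj]
          rintro ⟨i, hri, hsi⟩
          have hij : i = j := by
            by_contra hne
            have hg := Nat.dvd_gcd hri hpj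
            rw [(coprime_apply_of_mem_dkBox hr hne).gcd_eq_one] at hg
            exact hp.one_lt.ne' (Nat.dvd_one.1 hg)
          have hij' : i = j' := by
            by_contra hne
            have hg := Nat.dvd_gcd hsi hpj'
            rw [(coprime_apply_of_mem_dkBox hs hne).gcd_eq_one] at hg
            exact hp.one_lt.ne' (Nat.dvd_one.1 hg)
          exact hjj (hij.symm.trans hij')
      -- the other local factors are unchanged
      have hSq : ∀ q ∈ N.primeFactors.erase p,
          localFactor (Function.update r j (r j / p)) (Function.update s j' (s j' / p)) q =
            localFactor r s q := by
        intro q hq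
        obtain ⟨hqp, hqN⟩ := Finset.mem_erase.1 hq
        have hqprime := Nat.prime_of_mem_primeFactors hqN
        unfold localFactor
        simp only [prime_dvd_update_div_iff r j hp hqprime hqp hpj,
          prime_dvd_update_div_iff s j' hp hqprime hqp hpj']
      rw [hSp, Finset.prod_congr rfl hSq]

end Literature.NumberTheory.Sieve.FGKMT2018
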